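import Summits.QuantumFields.YangMills.Theorems.BalabanUVNodesN18TwoRunWindowLevelShiftRecord
import Summits.QuantumFields.YangMills.Theorems.BalabanUVNodesN22WindowSoftTwoPoint
import Summits.QuantumFields.YangMills.Theorems.BalabanUVNodesN22TermPolarizationLocalCauchy
import Literature.MathematicalPhysics.QuantumFieldTheory.Balaban1983to89.Node00.RateRecordW1Maps

/-!
# BalabanUVNodes ∕ N18 — THE TERMWISE RUN-DIFFERENCE ROAD: node N18's two-run letter for W1-20's (1.7) localized sum from PER-MATCHED-PAIR two-run bounds of
# the (2.13) terms on ONE torus `T^{(k+2)}_{K+1}`, the two runs' localization domains being MATCHED by def-W1's level-shift identity `𝐃_{k+2}(T_{K+1}) = 𝐃_{k+1}(T_K)`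
# (Track A, DAG node N18 = NE5; key K3⁸ `SpineGivenEndpointR13SepCoPHV` = stmt-QuantumFields-27366 (K3⁷ 20544 aside since route rev 28∕29); cell `pub-ymgap`,
# WIDTH SEAT `pub-ymgap-dag-n18-w2` g9, FILE 1 = PART 1; `--kind proof --supports stmt-QuantumFields-27366 --as helper`, COUNT-NEUTRAL; THEOREMS ONLY, 0 `def`, 0 `sorry`)

WHY.  g8's PART 1∕2 (`…N18TwoRunWindowLevelShift{,Record}`) proved that W1-19b's finite-volume two-run letter `WindowedStepRate … 1 …` — node N18's input — is, word
for word, an inequality between the (1.20) windows of TWO functionals on ONE torus `T^{(k+2)}_{K+1}` (`windowedStepRate_one_iff_sameTorus`: run A's level-`(k+1)`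
functional at run length `K` is read on run B's torus through pub-balaban's `siteShift` along `ladder F K k`), and unfolded the run difference of W1-20's (1.7)
localized sum into the difference of the two finite sums of (2.13) terms (`runDifference_localizedSum_apply`) — «the termwise target of dag-n22-c's two-point
machinery».  The two sums run over DIFFERENT catalogues, `𝐃_{k+2}(T_{K+1})` and `𝐃_{k+1}(T_K)`; def-W1's `RateRecordW1Maps.domSys_succ` ([I] (0.24)–(0.25): run B's
creation step `k+2` has run A's step-`(k+1)` spacing, ONE physical torus) says they are THE SAME domain system, and `castDom ∕ domEquiv` transport domains along it
(tree length preserved, `dj_castDom`).  THIS FILE reindexes run A's sum over run B's catalogue along that bijection, so that the run difference is ONE sum over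
`𝐃_{k+2}(T_{K+1})` of MATCHED-PAIR differences `Re E^{(k+2)}_{K+1}(X; w; ·) − Re E^{(k+1)}_K(cast X; tail w; · ∘ shift)`, and then runs the n22 lane's machinery
— J27's two-point step, J28's Cauchy bound, dag-n22-w2's (5.10) soft resummation and window isometry — at the RUN difference instead of the HISTORY difference:
C. King's «the error is the same graph with a difference of propagators on one line» ([King1986] p. 665) term by term, in def-B's ∕ def-W1's currency.

WHAT.
* §1 (one torus, two finite term catalogues `𝒳, 𝒳'` MATCHED by an equivalence `e : 𝒳 ≃ 𝒳'`; generic charts `ρ, bV`): `sum_functional_reindex` ·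
  ★ `abs_polScalar_sum_sub_sum_le_twoPointSum_of_equiv` (J27's hard two-point step for `Σ_{X∈𝒳} ℰ X − Σ_{X'∈𝒳'} ℰ' X'` under per-MATCHED-PAIR colour-diagonal
  kernel-difference bounds supported on the pair's sites) · ★ `abs_polWindow_sum_sub_sum_le_of_softKernelBound_of_equiv` (dag-n22-w2's soft (5.10)-resummed step on
  the `K`-th torus, matched pairs).
* §2 (W1-20's localized sum `localizedSum F S emb`; run pair `(K, K+1)`, levels `(k+1, k+2)`, history `w ∈ ℝ^{k+2}` ∕ `tail w`, torus `T^{(k+2)}_{K+1}`; matching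
  `castDom (domSys_succ F M K (k+1))`): `runA_localizedSum_levelShift_eq_sum_matched` (run A's level-shifted sum REINDEXED over run B's catalogue) ·
  `runDifference_localizedSum_eq_sum_matched` · ★ `abs_polWindow_runDifference_localizedSum_le_of_softKernelBound` (per matched pair the SOFT TWO-RUN kernel-difference
  bound `C·e^{−κ d(X)}·e^{−δ₀ dist(z·,X)}·e^{−δ₀ dist(0·,X)}` at the window sites + the three leaves of `B12Decay510` on a site geometry of `Site (F.P (K+1)) (k+2)` over
  run B's catalogue ⇒ `|Π^{(K+1)}_{k+2}[run B](z) − Π^{(K+1)}_{k+2}[run A ∘ shift](z)| ≤ C e^{δ₁M₉c₁}K₀K₁ e^{−δ₁ dist}`) · ★ `abs_polWindow_runDifference_localizedSum_le_soft_of_holomorphic`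
  (J29-soft twin: per matched pair, holomorphic extensions `G_B X ∕ G_A X` of the two terms' charts through ONE per-term site-weighted real-linear complexification `ι X`
  of the probe fields of `T^{(k+2)}_{K+1}`, and the TWO-RUN SUP BOUND `‖G_B X − G_A X‖ ≤ M X` on the ball ⇒ `≤ Σ_X 16 M(X) r⁻² w_X(z·) w_X(0·)`).
* §3 (eventually in `K`; the letters): ★★ `eventually_abs_polWindow_runDifference_localizedSum_le` (K-uniform leaves and per-pair soft bounds with weight `C_E·θ^{k+1}`,
  dag-n22-w2's window isometry shifted by one run ⇒ `∀ᶠ K, |…| ≤ C_E e^{δ₁M₉c₁}K₀K₁·θ^{k+1}·e^{−δ₁|z|₁}`) · ★★ `windowedStepRate_localizedSum_one_of_termwise`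
  (⇒ `WindowedStepRate F (localizedSum F S emb) ρ bV γ 1 δ₁ θ (C₅′·θ)`, `C₅′ := C_E e^{δ₁M₉c₁}K₀K₁`, through g8's `windowedStepRate_one_iff_sameTorus` — NO `C²` of the
  sum needed) · ★ `kernelStepRate_localizedSum_of_termwise` (+ W1-19b's `PolLimitsExist … (Window γ)` ⇒ node N18's letter `KernelStepRate … γ δ₁ θ C₅′`, dag-n18-w1's
  `kernelStepRate_of_windowed'` at `s = 1`).
* PART 2 (`…N18RunDifferenceOfLocalTermsRecord`, same namespace): the RECORD editions under W1-20's law `Localizes17OfRecord₁₃ F N θ S emb` —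
  `windowedStepRateOfRecord₁₃_one_of_termwise`, `kernelStepRateOfRecord₁₃_of_termwise` (the letter the K3 pin reads for node N18), `n18At_…_of_termwise`.

HONEST FRAMING — what this is NOT.  Count-neutral junction: reindexing a finite sum along def-W1's domain bijection, the n22 lane's J27∕J28 steps and dag-n22-w2's (5.10)
resummation + window isometry consumed BY NAME, one `Filter.Eventually` shifted by one run.  NO estimate of Bałaban's is proved or asserted: the per-matched-pair TWO-RUN
bound of the (2.13) terms read on one torus through the two runs' minimizers (term-level NE5 — [I] Thm 1's uniformity in the lattice spacing AS A RATE, King's u = 2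
statement (3.73) for the scalar model; NOT PRINTED for d = 4 Yang–Mills), the analyticity ∕ `C²` of the terms' charts ([I] p. 264), the leaves' K-uniform constants, the
(1.21)-existence of record and W1-20's law (1.7) are DISPLAYED hypotheses — NODE A's ∕ N10's ∕ the node's CONTENT; nothing of the merged term (1.6) or of the (2.13) terms is
constructed; no letter OF RECORD inhabited; N18 ∕ N22 ∕ (D4) NOT discharged; K3⁸ OPEN (skeleton v6 awaited), not claimed; counts UNMOVED (typed 28∕28 · discharged 5∕27
(A 5∕28)); one finite four-torus programme at fixed ε, Bałaban AS PRINTED; R4 closes the conditional finite-𝕋⁴ rung `BalabanLadder.UV` only — NOT ℝ⁴, NOT infinite volume,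
NOT OS, NOT a mass gap; the Clay problem is NOT proved by any of this.

References (TYPES only): [I] = [Balaban1987RG1] (0.24)–(0.25) p. 257, p. 257 (class 𝐃_j, d_j), Thm 1 p. 259, (1.7) p. 261, (1.18) p. 263, (1.20)–(1.21) p. 264, (4.35)–(4.37)
p. 282, (5.10) p. 293; [II] = [Balaban1988RG2Cluster] (2.13)–(2.14) pp. 14–15; C. King, CMP 102 (1986) [King1986] (3.73) p. 665.  Imports g8's PART 2 (p623234; through it PART 1,
def-W1's `U3KernelLetters` ∕ `LocalizedSum17`, dag-n18-w1's `…N18AtRecordOfKernelLetters`), dag-n22-w2's `…N22WindowSoftTwoPoint` (through it J27), dag-n22-c's J28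
`…N22TermPolarizationLocalCauchy`, def-W1's `Node00/RateRecordW1Maps` (`domSys_succ ∕ castDom ∕ domEquiv ∕ dj_castDom`) BY NAME; nothing re-declared.
-/

noncomputable section

namespace YMDAG.N18.RunDifferenceOfLocalTerms

open Filter Metric Set
open scoped BigOperators Topology
open Literature.MathematicalPhysics.QuantumFieldTheory.Balaban1983to89
open Literature.MathematicalPhysics.QuantumFieldTheory.Balaban1983to89.T4Continuum (T4Family)
open Literature.MathematicalPhysics.QuantumFieldTheory.Balaban1983to89.B12Sec2to5 (l1)
open Literature.MathematicalPhysics.QuantumFieldTheory.Balaban1983to89.FlowStep (Box)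
open Literature.MathematicalPhysics.QuantumFieldTheory.Balaban1983to89.B12PolarizationTensor120 (polComp expChart)
open Literature.MathematicalPhysics.QuantumFieldTheory.Balaban1983to89.Node00 (TermFamily1 polScalar polWindow siteOfInt)
open Literature.MathematicalPhysics.QuantumFieldTheory.Balaban1983to89.Node00.U3KernelLetters (WindowedStepRate KernelStepRate PolLimitsExist)
open Literature.MathematicalPhysics.QuantumFieldTheory.Balaban1983to89.Node00.LocalizedSum17 (localizedSum ReadingMaps)
open Literature.MathematicalPhysics.QuantumFieldTheory.Balaban1983to89.Node00.Sect2 (domSys)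
open Literature.MathematicalPhysics.QuantumFieldTheory.Balaban1983to89.Node00.W1 (ClusterTower castDom domEquiv domSys_succ dj_castDom)
open Literature.MathematicalPhysics.QuantumFieldTheory.Balaban1983to89.T4LevelShift (siteShift)
open Literature.MathematicalPhysics.QuantumFieldTheory.Balaban1983to89.T4OutputRate (Window)
open Literature.MathematicalPhysics.QuantumFieldTheory.Balaban1983to89.B12Decay510 (SiteGeometry GeomLeaf CubeSumLeaf TreeLeaf)
open Literature.MathematicalPhysics.QuantumFieldTheory.Balaban1983to89.B12Decay510Torus (pl1)
open YMDAG.N22.WindowOfLocalTerms (abs_polScalar_sum_sub_le_twoPointSum abs_polWindow_sum_sub_le_of_twoPointSum_le hterm_of_holomorphic_weighted contDiffAt_two_of_holomorphic)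
open YMDAG.N22.WindowSoftTwoPoint (abs_polWindow_sum_sub_le_of_softKernelBound pl1_siteOfInt_sub_eventually)
open YMDAG.N18.TwoRunWindowLevelShift (ladder windowedStepRate_one_iff_sameTorus)
open YMDAG.N18.AtRecordOfKernelLetters (kernelStepRate_of_windowed')

/-! ## §1 One torus, two term catalogues matched by an equivalence -/

section Matched

variable {𝔄 : Type*} [NormedRing 𝔄] [NormedAlgebra ℝ 𝔄] {V : Type*} [NormedAddCommGroup V] [NormedSpace ℝ V] {ι : Type*} [Fintype ι]
  {Λ T : Type*} [Fintype Λ] [Fintype T] [DecidableEq Λ] [DecidableEq T] {𝒳 𝒳' : Type*} [Fintype 𝒳] [Fintype 𝒳'] {Φ : Type*}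

omit [Fintype ι] in
/-- **REINDEXING A FINITE SUM OF FUNCTIONALS ALONG A MATCHING**: for an equivalence `e : 𝒳 ≃ 𝒳'` of the two catalogues, the functional `U ↦ Σ_{X'∈𝒳'} ℰ' X' U`
IS `U ↦ Σ_{X∈𝒳} ℰ' (e X) U` (`Equiv.sum_comp`; the run-A sum read over run B's catalogue). [cite: Balaban1987RG1, (1.7) p.261 and (0.24)-(0.25) p.257 (bookkeeping)] -/
theorem sum_functional_reindex (e : 𝒳 ≃ 𝒳') (ℰ' : 𝒳' → Φ → ℝ) : (fun U => ∑ X', ℰ' X' U) = fun U => ∑ X, ℰ' (e X) U := by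
  funext U
  exact (Equiv.sum_comp e (fun X' => ℰ' X' U)).symm

/-- ★ **J27's HARD TWO-POINT STEP FOR TWO MATCHED CATALOGUES** (the run-difference twin of `abs_polScalar_sum_sub_le_twoPointSum`): terms `ℰ X` (run B) and `ℰ' X'` (run A,
already read on run B's torus) with `C²` charts, matched by `e : 𝒳 ≃ 𝒳'`; if the colour-diagonal kernel DIFFERENCE of each matched pair `(X, e X)` at the pair of sites `(x, y)`
is `≤ a(X)` when both sites are the pair's (`supp X`) and `0` otherwise (`a ≥ 0`), then
`|Π[Σ_𝒳 ℰ](x,y) − Π[Σ_{𝒳'} ℰ'](x,y)| ≤ Σ_{X ∈ 𝒳, x,y ∈ supp X} a(X)`. [cite: Balaban1987RG1, (1.7) p.261, (1.18) p.263 and (1.20)-(1.21) p.264] -/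
theorem abs_polScalar_sum_sub_sum_le_twoPointSum_of_equiv (e : 𝒳 ≃ 𝒳') (ℰ : 𝒳 → (Λ → T → 𝔄) → ℝ) (ℰ' : 𝒳' → (Λ → T → 𝔄) → ℝ)
    (ρ : V →L[ℝ] 𝔄) (bV : Module.Basis ι ℝ V) (hℰ : ∀ X, ContDiffAt ℝ 2 (expChart (ℰ X) ρ) 0) (hℰ' : ∀ X', ContDiffAt ℝ 2 (expChart (ℰ' X') ρ) 0)
    (supp : 𝒳 → Set T) [∀ X, DecidablePred (· ∈ supp X)] (a : 𝒳 → ℝ) (ha : ∀ X, 0 ≤ a X) (μ : Λ) (x : T) (ν : Λ) (y : T)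
    (hterm : ∀ (X : 𝒳) (c : ι), |polComp ℝ (expChart (ℰ X) ρ) bV μ x c ν y c - polComp ℝ (expChart (ℰ' (e X)) ρ) bV μ x c ν y c| ≤
      if x ∈ supp X ∧ y ∈ supp X then a X else 0) :
    |polScalar (fun U => ∑ X, ℰ X U) ρ bV μ x ν y - polScalar (fun U => ∑ X', ℰ' X' U) ρ bV μ x ν y| ≤
      ∑ X ∈ Finset.univ.filter (fun X => x ∈ supp X ∧ y ∈ supp X), a X := by
  rw [sum_functional_reindex e ℰ']
  exact abs_polScalar_sum_sub_le_twoPointSum Finset.univ ℰ (fun X => ℰ' (e X)) ρ bV (fun X _ => hℰ X) (fun X _ => hℰ' (e X)) supp a (fun X _ => ha X)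
    μ x ν y (fun X _ c => hterm X c)

variable (F : T4Family)

/-- ★ **dag-n22-w2's SOFT (5.10)-RESUMMED STEP FOR TWO MATCHED CATALOGUES on the `K`-th torus** (the run-difference twin of `WindowSoftTwoPoint.abs_polWindow_sum_sub_le_of_softKernelBound`):
terms `ℰ X` over a catalogue `S` carrying the cube cover `C` and a site geometry `G` on `Site (F.P K) j`, terms `ℰ' X'` over a second catalogue `S'` matched by `e : S.Dom ≃ S'.Dom`
(both families read on the `K`-th torus, `C²` charts); if every matched pair's colour-diagonal kernel DIFFERENCE at the window sites obeys the SOFT bound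
`C_E e^{−κ d_j(X)} e^{−δ₀ dist(z·,X)} e^{−δ₀ dist(0·,X)}` ([I] p. 282 ∕ (4.35)), then under the three leaves
`|Π^{(K)}_j[Σ_S ℰ](z) − Π^{(K)}_j[Σ_{S'} ℰ'](z)| ≤ C_E e^{δ₁M₉c₁} K₀ K₁ e^{−δ₁ dist(z·, 0·)}`. [cite: Balaban1987RG1, (1.20)-(1.21) p.264, (4.35)-(4.37) p.282 and (5.10) p.293] -/
theorem abs_polWindow_sum_sub_sum_le_of_softKernelBound_of_equiv (K j : ℕ) {S S' : LocDomainSys} (e : S.Dom ≃ S'.Dom) {C : B12.CubeCover S}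
    (G : SiteGeometry C (Site (F.P K) j)) (ℰ : S.Dom → (Fin (F.P K).d → Site (F.P K) j → 𝔄) → ℝ) (ℰ' : S'.Dom → (Fin (F.P K).d → Site (F.P K) j → 𝔄) → ℝ)
    (ρ : V →L[ℝ] 𝔄) (bV : Module.Basis ι ℝ V) (hℰ : ∀ X, ContDiffAt ℝ 2 (expChart (ℰ X) ρ) 0) (hℰ' : ∀ X', ContDiffAt ℝ 2 (expChart (ℰ' X') ρ) 0)
    {dist : Site (F.P K) j → Site (F.P K) j → ℝ} {CE κ δ₀ δ₁ M₉ c₁ K0 K1 : ℝ} (hCE : 0 ≤ CE) (hK0 : 0 ≤ K0)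
    (hδ₁ : 0 ≤ δ₁) (hδ₁δ₀ : δ₁ ≤ δ₀ / 2) (hδ₁κ : δ₁ * M₉ ≤ κ / 2)
    (hgeo : GeomLeaf G dist M₉ c₁) (hcube : CubeSumLeaf G (δ₀ / 2) K1) (htree : TreeLeaf C (κ / 2) K0) (μ ν : Fin 4) (z : Fin 4 → ℤ)
    (hterm : ∀ (X : S.Dom) (c : ι),
      |polComp ℝ (expChart (ℰ X) ρ) bV (Fin.cast (F.P_d K).symm μ) (siteOfInt F K j z) c (Fin.cast (F.P_d K).symm ν) (siteOfInt F K j 0) c -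
          polComp ℝ (expChart (ℰ' (e X)) ρ) bV (Fin.cast (F.P_d K).symm μ) (siteOfInt F K j z) c (Fin.cast (F.P_d K).symm ν) (siteOfInt F K j 0) c| ≤
        CE * Real.exp (-κ * S.dj X) * Real.exp (-δ₀ * G.distD (siteOfInt F K j z) X) * Real.exp (-δ₀ * G.distD (siteOfInt F K j 0) X)) :
    |polWindow F K j (fun U => ∑ X, ℰ X U) ρ bV μ ν z - polWindow F K j (fun U => ∑ X', ℰ' X' U) ρ bV μ ν z| ≤
      CE * Real.exp (δ₁ * M₉ * c₁) * K0 * K1 * Real.exp (-δ₁ * dist (siteOfInt F K j z) (siteOfInt F K j 0)) := by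
  rw [sum_functional_reindex e ℰ']
  exact abs_polWindow_sum_sub_le_of_softKernelBound F K j G ℰ (fun X => ℰ' (e X)) ρ bV hℰ (fun X => hℰ' (e X)) hCE hK0 hδ₁ hδ₁δ₀ hδ₁κ hgeo hcube htree
    μ ν z hterm

end Matched

/-! ## §2 The run difference of W1-20's (1.7) localized sum on `T^{(k+2)}_{K+1}` as ONE matched sum over run B's catalogue -/

section LocalizedSum

variable {𝔄 : Type*} [NormedRing 𝔄] [NormedAlgebra ℝ 𝔄] {V : Type*} [NormedAddCommGroup V] [NormedSpace ℝ V] {ι : Type*} [Fintype ι] {𝔸 : Type*} {M : ℕ}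
variable (F : T4Family) (S : (K : ℕ) → ClusterTower (F.P K) 𝔸 M) (emb : ReadingMaps F 𝔄 𝔸) (ρ : V →L[ℝ] 𝔄) (bV : Module.Basis ι ℝ V)

omit [NormedRing 𝔄] [NormedAlgebra ℝ 𝔄] in
/-- **RUN A's LEVEL-SHIFTED LOCALIZED SUM REINDEXED OVER RUN B's CATALOGUE**: on `T^{(k+2)}_{K+1}`, run A's (1.7) sum at `(k, tail w, K)` read through the level shift is
the sum over run B's scale-`(k+2)` domains `X` of run A's term at the MATCHED domain `castDom (domSys_succ F M K (k+1)) X` (def-W1's `𝐃_{k+2}(T_{K+1}) = 𝐃_{k+1}(T_K)`,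
[I] (0.24)–(0.25)). [cite: Balaban1987RG1, (1.7) p.261 and (0.24)-(0.25) p.257; Balaban1988RG2Cluster, (2.14) p.15] -/
theorem runA_localizedSum_levelShift_eq_sum_matched (K k : ℕ) (w : Fin (k + 2) → ℝ) :
    (fun W' : Fin (F.P (K + 1)).d → Site (F.P (K + 1)) (k + 1 + 1) → 𝔄 => localizedSum F S emb k (Fin.tail w) K (fun κ y => W' κ (siteShift (ladder F K k) y))) =
      fun W' => ∑ X : (domSys (F.P (K + 1)) M (k + 1 + 1)).Dom,
        (((S K) k).E (Fin.tail w) (emb K k (fun κ y => W' κ (siteShift (ladder F K k) y))) (castDom (domSys_succ F M K (k + 1)) X)).re := by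
  funext W'
  exact (Equiv.sum_comp (domEquiv (domSys_succ F M K (k + 1))) (fun X' => (((S K) k).E (Fin.tail w)
    (emb K k (fun κ y => W' κ (siteShift (ladder F K k) y))) X').re)).symm

omit [NormedRing 𝔄] [NormedAlgebra ℝ 𝔄] in
/-- **THE RUN DIFFERENCE OF THE LOCALIZED SUM IS ONE MATCHED SUM** (g8's `runDifference_localizedSum_apply` with run A's sum reindexed):
`𝓓_{K,k,w}(W') = Σ_{X ∈ 𝐃_{k+2}(T_{K+1})} [Re E^{(k+2)}_{K+1}(X; w; emb W') − Re E^{(k+1)}_K(cast X; tail w; emb (W' ∘ shift))]` — the object King's «difference of propagators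
on one line» bounds term by term. [cite: Balaban1987RG1, (1.7) p.261 and (0.24)-(0.25) p.257; Balaban1988RG2Cluster, (2.13)-(2.14) pp.14-15; King1986, p.665] -/
theorem runDifference_localizedSum_eq_sum_matched [NormedRing 𝔄] (K k : ℕ) (w : Fin (k + 2) → ℝ) :
    (fun W' : Fin (F.P (K + 1)).d → Site (F.P (K + 1)) (k + 1 + 1) → 𝔄 =>
        localizedSum F S emb (k + 1) w (K + 1) W' - localizedSum F S emb k (Fin.tail w) K (fun κ y => W' κ (siteShift (ladder F K k) y))) =
      fun W' => ∑ X : (domSys (F.P (K + 1)) M (k + 1 + 1)).Dom,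
        ((((S (K + 1)) (k + 1)).E w (emb (K + 1) (k + 1) W') X).re -
          (((S K) k).E (Fin.tail w) (emb K k (fun κ y => W' κ (siteShift (ladder F K k) y))) (castDom (domSys_succ F M K (k + 1)) X)).re) := by
  funext W'
  rw [Finset.sum_sub_distrib]
  exact congrArg₂ (· - ·) rfl (congrFun (runA_localizedSum_levelShift_eq_sum_matched F S emb K k w) W')

/-- ★ **THE WINDOWED RUN-DIFFERENCE BOUND ON ONE TORUS FROM PER-MATCHED-PAIR SOFT TWO-RUN BOUNDS** (run pair `(K, K+1)`, levels `(k+1, k+2)`, history `w`).  On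
`T^{(k+2)}_{K+1}` with run B's catalogue `𝐃_{k+2}(T_{K+1})` carrying a cube cover `C` and a site geometry `G`, the two runs' (2.13) terms read in def-B's chart being `C²` at
`0`: IF every matched pair `(X, cast X)` has colour-diagonal kernel DIFFERENCE at the window sites bounded by the SOFT two-run majorant
`C e^{−κ d(X)} e^{−δ₀ dist(z·,X)} e^{−δ₀ dist(0·,X)}` (term-level NE5 with the (4.35) tails — DISPLAYED, the node's content), THEN under the three leaves
`|Π^{(K+1)}_{k+2}[run B; w](z) − Π^{(K+1)}_{k+2}[run A ∘ shift; tail w](z)| ≤ C e^{δ₁M₉c₁} K₀ K₁ e^{−δ₁ dist(z·,0·)}`.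
[cite: Balaban1987RG1, Thm 1 p.259, (1.7) p.261, (1.20)-(1.21) p.264, (4.35)-(4.37) p.282 and (5.10) p.293; King1986, (3.73) p.665] -/
theorem abs_polWindow_runDifference_localizedSum_le_of_softKernelBound (K k : ℕ) (w : Fin (k + 2) → ℝ)
    {C : B12.CubeCover (domSys (F.P (K + 1)) M (k + 1 + 1))} (G : SiteGeometry C (Site (F.P (K + 1)) (k + 1 + 1)))
    (hB : ∀ X : (domSys (F.P (K + 1)) M (k + 1 + 1)).Dom,
      ContDiffAt ℝ 2 (expChart (fun W' => (((S (K + 1)) (k + 1)).E w (emb (K + 1) (k + 1) W') X).re) ρ) 0)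
    (hA : ∀ X' : (domSys (F.P K) M (k + 1)).Dom,
      ContDiffAt ℝ 2 (expChart (fun W' : Fin (F.P (K + 1)).d → Site (F.P (K + 1)) (k + 1 + 1) → 𝔄 =>
        (((S K) k).E (Fin.tail w) (emb K k (fun κ y => W' κ (siteShift (ladder F K k) y))) X').re) ρ) 0)
    {dist : Site (F.P (K + 1)) (k + 1 + 1) → Site (F.P (K + 1)) (k + 1 + 1) → ℝ} {CE κ δ₀ δ₁ M₉ c₁ K0 K1 : ℝ} (hCE : 0 ≤ CE) (hK0 : 0 ≤ K0)
    (hδ₁ : 0 ≤ δ₁) (hδ₁δ₀ : δ₁ ≤ δ₀ / 2) (hδ₁κ : δ₁ * M₉ ≤ κ / 2)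
    (hgeo : GeomLeaf G dist M₉ c₁) (hcube : CubeSumLeaf G (δ₀ / 2) K1) (htree : TreeLeaf C (κ / 2) K0) (μ ν : Fin 4) (z : Fin 4 → ℤ)
    (hterm : ∀ (X : (domSys (F.P (K + 1)) M (k + 1 + 1)).Dom) (c : ι),
      |polComp ℝ (expChart (fun W' => (((S (K + 1)) (k + 1)).E w (emb (K + 1) (k + 1) W') X).re) ρ) bV
            (Fin.cast (F.P_d (K + 1)).symm μ) (siteOfInt F (K + 1) (k + 1 + 1) z) c (Fin.cast (F.P_d (K + 1)).symm ν) (siteOfInt F (K + 1) (k + 1 + 1) 0) c -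
          polComp ℝ (expChart (fun W' : Fin (F.P (K + 1)).d → Site (F.P (K + 1)) (k + 1 + 1) → 𝔄 =>
            (((S K) k).E (Fin.tail w) (emb K k (fun κ y => W' κ (siteShift (ladder F K k) y))) (castDom (domSys_succ F M K (k + 1)) X)).re) ρ) bV
            (Fin.cast (F.P_d (K + 1)).symm μ) (siteOfInt F (K + 1) (k + 1 + 1) z) c (Fin.cast (F.P_d (K + 1)).symm ν) (siteOfInt F (K + 1) (k + 1 + 1) 0) c| ≤
        CE * Real.exp (-κ * (domSys (F.P (K + 1)) M (k + 1 + 1)).dj X) * Real.exp (-δ₀ * G.distD (siteOfInt F (K + 1) (k + 1 + 1) z) X) *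
          Real.exp (-δ₀ * G.distD (siteOfInt F (K + 1) (k + 1 + 1) 0) X)) :
    |polWindow F (K + 1) (k + 1 + 1) (localizedSum F S emb (k + 1) w (K + 1)) ρ bV μ ν z -
        polWindow F (K + 1) (k + 1 + 1)
          (fun W' : Fin (F.P (K + 1)).d → Site (F.P (K + 1)) (k + 1 + 1) → 𝔄 => localizedSum F S emb k (Fin.tail w) K (fun κ y => W' κ (siteShift (ladder F K k) y)))
          ρ bV μ ν z| ≤
      CE * Real.exp (δ₁ * M₉ * c₁) * K0 * K1 * Real.exp (-δ₁ * dist (siteOfInt F (K + 1) (k + 1 + 1) z) (siteOfInt F (K + 1) (k + 1 + 1) 0)) := by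
  have e1 : localizedSum F S emb (k + 1) w (K + 1) =
      fun U => ∑ X : (domSys (F.P (K + 1)) M (k + 1 + 1)).Dom, (((S (K + 1)) (k + 1)).E w (emb (K + 1) (k + 1) U) X).re := rfl
  have e2 : (fun W' : Fin (F.P (K + 1)).d → Site (F.P (K + 1)) (k + 1 + 1) → 𝔄 =>
      localizedSum F S emb k (Fin.tail w) K (fun κ y => W' κ (siteShift (ladder F K k) y))) =
      fun U => ∑ X' : (domSys (F.P K) M (k + 1)).Dom, (((S K) k).E (Fin.tail w) (emb K k (fun κ y => U κ (siteShift (ladder F K k) y))) X').re := rfl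
  rw [e1, e2]
  exact abs_polWindow_sum_sub_sum_le_of_softKernelBound_of_equiv F (K + 1) (k + 1 + 1) (domEquiv (domSys_succ F M K (k + 1))) G
    (fun X W' => (((S (K + 1)) (k + 1)).E w (emb (K + 1) (k + 1) W') X).re)
    (fun X' (W' : Fin (F.P (K + 1)).d → Site (F.P (K + 1)) (k + 1 + 1) → 𝔄) =>
      (((S K) k).E (Fin.tail w) (emb K k (fun κ y => W' κ (siteShift (ladder F K k) y))) X').re)
    ρ bV hB hA hCE hK0 hδ₁ hδ₁δ₀ hδ₁κ hgeo hcube htree μ ν z hterm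

variable {Ec : Type*} [NormedAddCommGroup Ec] [NormedSpace ℂ Ec]

/-- ★ **SOFT EDITION FROM HOLOMORPHY + A TERM-LEVEL TWO-RUN SUP BOUND** (the run-difference twin of dag-n22-c's J29 `abs_polWindow_localizedSum_sub_le_soft`; the road of the
reading of record, NO locality law).  On `T^{(k+2)}_{K+1}`: if every matched pair of (2.13) terms, read in def-B's exponential chart, is the real part of functions `G_B X`
(run B's term) ∕ `G_A X` (run A's term at `cast X`, history `tail w`, read through the level shift) holomorphic on an open `U X ⊇ ball 0 r` of a complex normed space through ONE
per-term real-linear complexification `ι X` of the probe fields whose one-site colour directions carry SITE WEIGHTS `‖ι X e_{l,t,c}‖ ≤ w X t` ([I] (4.35)∕(4.37): directions far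
from `X` are cheap), with the TWO-RUN SUP BOUND `‖G_B X − G_A X‖ ≤ M X` on the ball (term-level NE5 — King's «difference of propagators on one line»; DISPLAYED), then
`|Π^{(K+1)}_{k+2}[run B; w](z) − Π^{(K+1)}_{k+2}[run A ∘ shift; tail w](z)| ≤ Σ_X 16 M(X) r⁻² · w_X(z·) · w_X(0·)` — the soft two-point sum dag-n22-w2's (5.10) leaves resum.
[cite: Balaban1987RG1, Thm 1 p.259, (1.7) p.261, (1.20)-(1.21) p.264, (4.35)-(4.37) p.282 and (5.10) p.293; King1986, (3.73) p.665] -/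
theorem abs_polWindow_runDifference_localizedSum_le_soft_of_holomorphic (K k : ℕ) (w : Fin (k + 2) → ℝ)
    (ιc : (domSys (F.P (K + 1)) M (k + 1 + 1)).Dom → ((Fin (F.P (K + 1)).d → Site (F.P (K + 1)) (k + 1 + 1) → V) →L[ℝ] Ec))
    (GB GA : (domSys (F.P (K + 1)) M (k + 1 + 1)).Dom → Ec → ℂ) (U : (domSys (F.P (K + 1)) M (k + 1 + 1)).Dom → Set Ec) (hU : ∀ X, IsOpen (U X))
    (hGB : ∀ X, DifferentiableOn ℂ (GB X) (U X)) (hGA : ∀ X, DifferentiableOn ℂ (GA X) (U X)) {r : ℝ} (hr : 0 < r) (hrU : ∀ X, ball (0 : Ec) r ⊆ U X)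
    (hfB : ∀ X B, expChart (fun W' => (((S (K + 1)) (k + 1)).E w (emb (K + 1) (k + 1) W') X).re) ρ B = (GB X (ιc X B)).re)
    (hfA : ∀ X B, expChart (fun W' : Fin (F.P (K + 1)).d → Site (F.P (K + 1)) (k + 1 + 1) → 𝔄 =>
      (((S K) k).E (Fin.tail w) (emb K k (fun κ y => W' κ (siteShift (ladder F K k) y))) (castDom (domSys_succ F M K (k + 1)) X)).re) ρ B = (GA X (ιc X B)).re)
    (Mx : (domSys (F.P (K + 1)) M (k + 1 + 1)).Dom → ℝ) (hM : ∀ X, ∀ ζ ∈ ball (0 : Ec) r, ‖GB X ζ - GA X ζ‖ ≤ Mx X)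
    (wt : (domSys (F.P (K + 1)) M (k + 1 + 1)).Dom → Site (F.P (K + 1)) (k + 1 + 1) → ℝ) (hw₀ : ∀ X t, 0 ≤ wt X t)
    (hw : ∀ X (l : Fin (F.P (K + 1)).d) (t : Site (F.P (K + 1)) (k + 1 + 1)) (c : ι), ‖ιc X (Pi.single l (Pi.single t (bV c)))‖ ≤ wt X t)
    (μ ν : Fin 4) (z : Fin 4 → ℤ) :
    |polWindow F (K + 1) (k + 1 + 1) (localizedSum F S emb (k + 1) w (K + 1)) ρ bV μ ν z -
        polWindow F (K + 1) (k + 1 + 1)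
          (fun W' : Fin (F.P (K + 1)).d → Site (F.P (K + 1)) (k + 1 + 1) → 𝔄 => localizedSum F S emb k (Fin.tail w) K (fun κ y => W' κ (siteShift (ladder F K k) y)))
          ρ bV μ ν z| ≤
      ∑ X : (domSys (F.P (K + 1)) M (k + 1 + 1)).Dom,
        16 * Mx X / r ^ 2 * (wt X (siteOfInt F (K + 1) (k + 1 + 1) z) * wt X (siteOfInt F (K + 1) (k + 1 + 1) 0)) := by
  classical
  have hι0 : ∀ X, ιc X 0 ∈ U X := fun X => by rw [map_zero]; exact hrU X (mem_ball_self hr)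
  have hM0 : ∀ X, 0 ≤ Mx X := fun X => (norm_nonneg _).trans (hM X 0 (mem_ball_self hr))
  have e1 : localizedSum F S emb (k + 1) w (K + 1) =
      fun W => ∑ X : (domSys (F.P (K + 1)) M (k + 1 + 1)).Dom, (((S (K + 1)) (k + 1)).E w (emb (K + 1) (k + 1) W) X).re := rfl
  rw [e1, runA_localizedSum_levelShift_eq_sum_matched F S emb K k w]
  have h := abs_polScalar_sum_sub_le_twoPointSum Finset.univ
    (fun X W' => (((S (K + 1)) (k + 1)).E w (emb (K + 1) (k + 1) W') X).re)
    (fun X (W' : Fin (F.P (K + 1)).d → Site (F.P (K + 1)) (k + 1 + 1) → 𝔄) =>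
      (((S K) k).E (Fin.tail w) (emb K k (fun κ y => W' κ (siteShift (ladder F K k) y))) (castDom (domSys_succ F M K (k + 1)) X)).re) ρ bV
    (fun X _ => by rw [show expChart (fun W' => (((S (K + 1)) (k + 1)).E w (emb (K + 1) (k + 1) W') X).re) ρ = fun B => (GB X (ιc X B)).re from funext (hfB X)]
                   exact contDiffAt_two_of_holomorphic (GB X) (hGB X) (hU X) (ιc X) (hι0 X))
    (fun X _ => by rw [show expChart (fun W' : Fin (F.P (K + 1)).d → Site (F.P (K + 1)) (k + 1 + 1) → 𝔄 =>
                      (((S K) k).E (Fin.tail w) (emb K k (fun κ y => W' κ (siteShift (ladder F K k) y))) (castDom (domSys_succ F M K (k + 1)) X)).re) ρ =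
                      fun B => (GA X (ιc X B)).re from funext (hfA X)]
                   exact contDiffAt_two_of_holomorphic (GA X) (hGA X) (hU X) (ιc X) (hι0 X))
    (fun _ => (Set.univ : Set (Site (F.P (K + 1)) (k + 1 + 1))))
    (fun X => 16 * Mx X / r ^ 2 * (wt X (siteOfInt F (K + 1) (k + 1 + 1) z) * wt X (siteOfInt F (K + 1) (k + 1 + 1) 0)))
    (fun X _ => by have := hM0 X; have := hw₀ X (siteOfInt F (K + 1) (k + 1 + 1) z); have := hw₀ X (siteOfInt F (K + 1) (k + 1 + 1) 0); positivity)
    (Fin.cast (F.P_d (K + 1)).symm μ) (siteOfInt F (K + 1) (k + 1 + 1) z) (Fin.cast (F.P_d (K + 1)).symm ν) (siteOfInt F (K + 1) (k + 1 + 1) 0)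
    (fun X _ c => by
      rw [if_pos ⟨Set.mem_univ _, Set.mem_univ _⟩]
      exact hterm_of_holomorphic_weighted _ _ ρ bV (GB X) (GA X) (hGB X) (hGA X) (hU X) hr (hrU X) (hM X) (ιc X) (hfB X) (hfA X) (wt X) (hw X) _ _ _ _ c)
  rw [Finset.filter_true_of_mem (fun X _ => ⟨Set.mem_univ _, Set.mem_univ _⟩)] at h
  exact h

end LocalizedSum

/-! ## §3 Eventually in the run length `K`: the windowed letter and node N18's letter `KernelStepRate` for the localized sum -/

section Letters

variable {𝔄 : Type*} [NormedRing 𝔄] [NormedAlgebra ℝ 𝔄] {V : Type*} [NormedAddCommGroup V] [NormedSpace ℝ V] {ι : Type*} [Fintype ι] {𝔸 : Type*} {M : ℕ}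
variable (F : T4Family) (S : (K : ℕ) → ClusterTower (F.P K) 𝔸 M) (emb : ReadingMaps F 𝔄 𝔸) (ρ : V →L[ℝ] 𝔄) (bV : Module.Basis ι ℝ V)

/-- ★★ **K-UNIFORM PER-PAIR SOFT TWO-RUN BOUNDS ⇒ THE WINDOWED RUN-DIFFERENCE BOUND, EVENTUALLY IN `K`** (one level `k`, one box history `w`, one kernel entry).  For every run
pair `(K, K+1)`: a cube cover `C K` and a site geometry `G K` on `Site (F.P (K+1)) (k+2)` over run B's catalogue with the three leaves at `K`-FREE constants `(M₉, c₁, K₁, K₀)` in the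
periodic ℓ¹ distance, `C²` charts, and per matched pair the soft two-run bound with `K`-free `(C_E·θ^{k+1}, κ, δ₀)`; THEN — dag-n22-w2's window isometry `pl1_siteOfInt_sub_eventually`
one run up — for all large `K`, `|Π^{(K+1)}_{k+2}[run B; w](z) − Π^{(K+1)}_{k+2}[run A ∘ shift; tail w](z)| ≤ C_E e^{δ₁M₉c₁} K₀ K₁ · θ^{k+1} · e^{−δ₁|z|₁}`.
[cite: Balaban1987RG1, Thm 1 p.259, (1.20)-(1.21) p.264 and (5.10) p.293; King1986, (3.73) p.665] -/
theorem eventually_abs_polWindow_runDifference_localizedSum_le (k : ℕ) (w : Fin (k + 2) → ℝ)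
    (C : (K : ℕ) → B12.CubeCover (domSys (F.P (K + 1)) M (k + 1 + 1))) (G : (K : ℕ) → SiteGeometry (C K) (Site (F.P (K + 1)) (k + 1 + 1)))
    (hB : ∀ (K : ℕ) (X : (domSys (F.P (K + 1)) M (k + 1 + 1)).Dom),
      ContDiffAt ℝ 2 (expChart (fun W' => (((S (K + 1)) (k + 1)).E w (emb (K + 1) (k + 1) W') X).re) ρ) 0)
    (hA : ∀ (K : ℕ) (X' : (domSys (F.P K) M (k + 1)).Dom),
      ContDiffAt ℝ 2 (expChart (fun W' : Fin (F.P (K + 1)).d → Site (F.P (K + 1)) (k + 1 + 1) → 𝔄 =>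
        (((S K) k).E (Fin.tail w) (emb K k (fun κ y => W' κ (siteShift (ladder F K k) y))) X').re) ρ) 0)
    {CE θ κ δ₀ δ₁ M₉ c₁ K0 K1 : ℝ} (hCE : 0 ≤ CE) (hθ : 0 ≤ θ) (hK0 : 0 ≤ K0) (hδ₁ : 0 ≤ δ₁) (hδ₁δ₀ : δ₁ ≤ δ₀ / 2) (hδ₁κ : δ₁ * M₉ ≤ κ / 2)
    (hgeo : ∀ K, GeomLeaf (G K) (fun x y => pl1 (x - y)) M₉ c₁) (hcube : ∀ K, CubeSumLeaf (G K) (δ₀ / 2) K1) (htree : ∀ K, TreeLeaf (C K) (κ / 2) K0)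
    (μ ν : Fin 4) (z : Fin 4 → ℤ)
    (hterm : ∀ (K : ℕ) (X : (domSys (F.P (K + 1)) M (k + 1 + 1)).Dom) (c : ι),
      |polComp ℝ (expChart (fun W' => (((S (K + 1)) (k + 1)).E w (emb (K + 1) (k + 1) W') X).re) ρ) bV
            (Fin.cast (F.P_d (K + 1)).symm μ) (siteOfInt F (K + 1) (k + 1 + 1) z) c (Fin.cast (F.P_d (K + 1)).symm ν) (siteOfInt F (K + 1) (k + 1 + 1) 0) c -
          polComp ℝ (expChart (fun W' : Fin (F.P (K + 1)).d → Site (F.P (K + 1)) (k + 1 + 1) → 𝔄 =>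
            (((S K) k).E (Fin.tail w) (emb K k (fun κ y => W' κ (siteShift (ladder F K k) y))) (castDom (domSys_succ F M K (k + 1)) X)).re) ρ) bV
            (Fin.cast (F.P_d (K + 1)).symm μ) (siteOfInt F (K + 1) (k + 1 + 1) z) c (Fin.cast (F.P_d (K + 1)).symm ν) (siteOfInt F (K + 1) (k + 1 + 1) 0) c| ≤
        CE * θ ^ (k + 1) * Real.exp (-κ * (domSys (F.P (K + 1)) M (k + 1 + 1)).dj X) * Real.exp (-δ₀ * (G K).distD (siteOfInt F (K + 1) (k + 1 + 1) z) X) *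
          Real.exp (-δ₀ * (G K).distD (siteOfInt F (K + 1) (k + 1 + 1) 0) X)) :
    ∀ᶠ K in atTop,
      |polWindow F (K + 1) (k + 1 + 1) (localizedSum F S emb (k + 1) w (K + 1)) ρ bV μ ν z -
          polWindow F (K + 1) (k + 1 + 1)
            (fun W' : Fin (F.P (K + 1)).d → Site (F.P (K + 1)) (k + 1 + 1) → 𝔄 => localizedSum F S emb k (Fin.tail w) K (fun κ y => W' κ (siteShift (ladder F K k) y)))
            ρ bV μ ν z| ≤
        CE * Real.exp (δ₁ * M₉ * c₁) * K0 * K1 * θ ^ (k + 1) * Real.exp (-(δ₁ * l1 z)) := by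
  have hiso : ∀ᶠ K in atTop, pl1 (siteOfInt F (K + 1) (k + 1 + 1) z - siteOfInt F (K + 1) (k + 1 + 1) 0) = l1 z :=
    (tendsto_add_atTop_nat 1).eventually (pl1_siteOfInt_sub_eventually F (k + 1 + 1) z)
  filter_upwards [hiso] with K hK
  have h := abs_polWindow_runDifference_localizedSum_le_of_softKernelBound F S emb ρ bV K k w (G K) (hB K) (hA K) (dist := fun x y => pl1 (x - y))
    (mul_nonneg hCE (pow_nonneg hθ _)) hK0 hδ₁ hδ₁δ₀ hδ₁κ (hgeo K) (hcube K) (htree K) μ ν z (hterm K)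
  rw [hK] at h
  calc _ ≤ CE * θ ^ (k + 1) * Real.exp (δ₁ * M₉ * c₁) * K0 * K1 * Real.exp (-δ₁ * l1 z) := h
    _ = CE * Real.exp (δ₁ * M₉ * c₁) * K0 * K1 * θ ^ (k + 1) * Real.exp (-(δ₁ * l1 z)) := by rw [neg_mul]; ring

/-- ★★ **W1-19b's TWO-RUN LETTER FOR THE LOCALIZED SUM FROM TERMWISE TWO-RUN BOUNDS** (volume shift `s = 1`).  If for EVERY level `k` and box history `w ∈ ]0,γ]^{k+2}` the
hypotheses of `eventually_abs_polWindow_runDifference_localizedSum_le` hold with constants `(C_E, θ, κ, δ₀, δ₁, M₉, c₁, K₀, K₁)` free of `k` and `K` (cube covers and site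
geometries may depend on `k, K`), then `WindowedStepRate F (localizedSum F S emb) ρ bV γ 1 δ₁ θ (C₅′·θ)` with `C₅′ := C_E e^{δ₁M₉c₁} K₀ K₁` — through g8's
`windowedStepRate_one_iff_sameTorus` (pure rewriting: NO `C²` of the sum is needed). [cite: Balaban1987RG1, Thm 1 p.259, (1.7) p.261, (1.20)-(1.21) p.264 and (5.10) p.293] -/
theorem windowedStepRate_localizedSum_one_of_termwise {γ : ℝ}
    (C : (k K : ℕ) → B12.CubeCover (domSys (F.P (K + 1)) M (k + 1 + 1))) (G : (k K : ℕ) → SiteGeometry (C k K) (Site (F.P (K + 1)) (k + 1 + 1)))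
    (hB : ∀ (k : ℕ) (w : Fin (k + 2) → ℝ), w ∈ Box γ (k + 1) → ∀ (K : ℕ) (X : (domSys (F.P (K + 1)) M (k + 1 + 1)).Dom),
      ContDiffAt ℝ 2 (expChart (fun W' => (((S (K + 1)) (k + 1)).E w (emb (K + 1) (k + 1) W') X).re) ρ) 0)
    (hA : ∀ (k : ℕ) (w : Fin (k + 2) → ℝ), w ∈ Box γ (k + 1) → ∀ (K : ℕ) (X' : (domSys (F.P K) M (k + 1)).Dom),
      ContDiffAt ℝ 2 (expChart (fun W' : Fin (F.P (K + 1)).d → Site (F.P (K + 1)) (k + 1 + 1) → 𝔄 =>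
        (((S K) k).E (Fin.tail w) (emb K k (fun κ y => W' κ (siteShift (ladder F K k) y))) X').re) ρ) 0)
    {CE θ κ δ₀ δ₁ M₉ c₁ K0 K1 : ℝ} (hCE : 0 ≤ CE) (hθ : 0 ≤ θ) (hK0 : 0 ≤ K0) (hδ₁ : 0 ≤ δ₁) (hδ₁δ₀ : δ₁ ≤ δ₀ / 2) (hδ₁κ : δ₁ * M₉ ≤ κ / 2)
    (hgeo : ∀ k K, GeomLeaf (G k K) (fun x y => pl1 (x - y)) M₉ c₁) (hcube : ∀ k K, CubeSumLeaf (G k K) (δ₀ / 2) K1) (htree : ∀ k K, TreeLeaf (C k K) (κ / 2) K0)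
    (hterm : ∀ (k : ℕ) (w : Fin (k + 2) → ℝ), w ∈ Box γ (k + 1) → ∀ (K : ℕ) (X : (domSys (F.P (K + 1)) M (k + 1 + 1)).Dom) (μ ν : Fin 4) (z : Fin 4 → ℤ) (c : ι),
      |polComp ℝ (expChart (fun W' => (((S (K + 1)) (k + 1)).E w (emb (K + 1) (k + 1) W') X).re) ρ) bV
            (Fin.cast (F.P_d (K + 1)).symm μ) (siteOfInt F (K + 1) (k + 1 + 1) z) c (Fin.cast (F.P_d (K + 1)).symm ν) (siteOfInt F (K + 1) (k + 1 + 1) 0) c -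
          polComp ℝ (expChart (fun W' : Fin (F.P (K + 1)).d → Site (F.P (K + 1)) (k + 1 + 1) → 𝔄 =>
            (((S K) k).E (Fin.tail w) (emb K k (fun κ y => W' κ (siteShift (ladder F K k) y))) (castDom (domSys_succ F M K (k + 1)) X)).re) ρ) bV
            (Fin.cast (F.P_d (K + 1)).symm μ) (siteOfInt F (K + 1) (k + 1 + 1) z) c (Fin.cast (F.P_d (K + 1)).symm ν) (siteOfInt F (K + 1) (k + 1 + 1) 0) c| ≤
        CE * θ ^ (k + 1) * Real.exp (-κ * (domSys (F.P (K + 1)) M (k + 1 + 1)).dj X) * Real.exp (-δ₀ * (G k K).distD (siteOfInt F (K + 1) (k + 1 + 1) z) X) *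
          Real.exp (-δ₀ * (G k K).distD (siteOfInt F (K + 1) (k + 1 + 1) 0) X)) :
    WindowedStepRate F (localizedSum F S emb) ρ bV γ 1 δ₁ θ (CE * Real.exp (δ₁ * M₉ * c₁) * K0 * K1 * θ) := by
  refine (windowedStepRate_one_iff_sameTorus F (localizedSum F S emb) ρ bV γ δ₁ θ _).2 fun k w hw μ ν x => ?_
  have h := eventually_abs_polWindow_runDifference_localizedSum_le F S emb ρ bV k w (C k) (G k) (hB k w hw) (hA k w hw) hCE hθ hK0 hδ₁ hδ₁δ₀ hδ₁κ
    (hgeo k) (hcube k) (htree k) μ ν x (fun K X c => hterm k w hw K X μ ν x c)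
  filter_upwards [h] with K hK
  calc _ ≤ CE * Real.exp (δ₁ * M₉ * c₁) * K0 * K1 * θ ^ (k + 1) * Real.exp (-(δ₁ * l1 x)) := hK
    _ = CE * Real.exp (δ₁ * M₉ * c₁) * K0 * K1 * θ * θ ^ k * Real.exp (-δ₁ * l1 x) := by rw [pow_succ, neg_mul]; ring

/-- ★ **NODE N18's LETTER `KernelStepRate` FOR THE LOCALIZED SUM FROM TERMWISE TWO-RUN BOUNDS + (1.21)-EXISTENCE** (dag-n18-w1's `kernelStepRate_of_windowed'` at `s = 1`):
under the hypotheses of `windowedStepRate_localizedSum_one_of_termwise` and W1-19b's `PolLimitsExist F (localizedSum F S emb) ρ bV (Window γ)`,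
`KernelStepRate F (localizedSum F S emb) ρ bV γ δ₁ θ (C_E e^{δ₁M₉c₁} K₀ K₁)`. [cite: Balaban1987RG1, Thm 1 p.259, (1.7) p.261 and (1.21) p.264] -/
theorem kernelStepRate_localizedSum_of_termwise {γ : ℝ} (hex : PolLimitsExist F (localizedSum F S emb) ρ bV (Window γ))
    (C : (k K : ℕ) → B12.CubeCover (domSys (F.P (K + 1)) M (k + 1 + 1))) (G : (k K : ℕ) → SiteGeometry (C k K) (Site (F.P (K + 1)) (k + 1 + 1)))
    (hB : ∀ (k : ℕ) (w : Fin (k + 2) → ℝ), w ∈ Box γ (k + 1) → ∀ (K : ℕ) (X : (domSys (F.P (K + 1)) M (k + 1 + 1)).Dom),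
      ContDiffAt ℝ 2 (expChart (fun W' => (((S (K + 1)) (k + 1)).E w (emb (K + 1) (k + 1) W') X).re) ρ) 0)
    (hA : ∀ (k : ℕ) (w : Fin (k + 2) → ℝ), w ∈ Box γ (k + 1) → ∀ (K : ℕ) (X' : (domSys (F.P K) M (k + 1)).Dom),
      ContDiffAt ℝ 2 (expChart (fun W' : Fin (F.P (K + 1)).d → Site (F.P (K + 1)) (k + 1 + 1) → 𝔄 =>
        (((S K) k).E (Fin.tail w) (emb K k (fun κ y => W' κ (siteShift (ladder F K k) y))) X').re) ρ) 0)
    {CE θ κ δ₀ δ₁ M₉ c₁ K0 K1 : ℝ} (hCE : 0 ≤ CE) (hθ : 0 ≤ θ) (hK0 : 0 ≤ K0) (hδ₁ : 0 ≤ δ₁) (hδ₁δ₀ : δ₁ ≤ δ₀ / 2) (hδ₁κ : δ₁ * M₉ ≤ κ / 2)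
    (hgeo : ∀ k K, GeomLeaf (G k K) (fun x y => pl1 (x - y)) M₉ c₁) (hcube : ∀ k K, CubeSumLeaf (G k K) (δ₀ / 2) K1) (htree : ∀ k K, TreeLeaf (C k K) (κ / 2) K0)
    (hterm : ∀ (k : ℕ) (w : Fin (k + 2) → ℝ), w ∈ Box γ (k + 1) → ∀ (K : ℕ) (X : (domSys (F.P (K + 1)) M (k + 1 + 1)).Dom) (μ ν : Fin 4) (z : Fin 4 → ℤ) (c : ι),
      |polComp ℝ (expChart (fun W' => (((S (K + 1)) (k + 1)).E w (emb (K + 1) (k + 1) W') X).re) ρ) bV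
            (Fin.cast (F.P_d (K + 1)).symm μ) (siteOfInt F (K + 1) (k + 1 + 1) z) c (Fin.cast (F.P_d (K + 1)).symm ν) (siteOfInt F (K + 1) (k + 1 + 1) 0) c -
          polComp ℝ (expChart (fun W' : Fin (F.P (K + 1)).d → Site (F.P (K + 1)) (k + 1 + 1) → 𝔄 =>
            (((S K) k).E (Fin.tail w) (emb K k (fun κ y => W' κ (siteShift (ladder F K k) y))) (castDom (domSys_succ F M K (k + 1)) X)).re) ρ) bV
            (Fin.cast (F.P_d (K + 1)).symm μ) (siteOfInt F (K + 1) (k + 1 + 1) z) c (Fin.cast (F.P_d (K + 1)).symm ν) (siteOfInt F (K + 1) (k + 1 + 1) 0) c| ≤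
        CE * θ ^ (k + 1) * Real.exp (-κ * (domSys (F.P (K + 1)) M (k + 1 + 1)).dj X) * Real.exp (-δ₀ * (G k K).distD (siteOfInt F (K + 1) (k + 1 + 1) z) X) *
          Real.exp (-δ₀ * (G k K).distD (siteOfInt F (K + 1) (k + 1 + 1) 0) X)) :
    KernelStepRate F (localizedSum F S emb) ρ bV γ δ₁ θ (CE * Real.exp (δ₁ * M₉ * c₁) * K0 * K1) :=
  kernelStepRate_of_windowed' F ρ bV 1 hex
    (windowedStepRate_localizedSum_one_of_termwise F S emb ρ bV C G hB hA hCE hθ hK0 hδ₁ hδ₁δ₀ hδ₁κ hgeo hcube htree hterm)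

end Letters

end YMDAG.N18.RunDifferenceOfLocalTerms

end
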